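import Literature.NumberTheory.GaloisRepresentations.FrobeniusPlaces
import Literature.NumberTheory.GaloisRepresentations.LocalExistenceLubinTate
import Literature.NumberTheory.GaloisRepresentations.LocalWeilDatumValuation
import Literature.NumberTheory.GaloisCohomology.RestrictedRamificationCdTwoBaseChange
import Literature.NumberTheory.EllipticCurves.CMNewformOfHeckeCharacterProofs
import Literature.NumberTheory.GaloisRepresentations.PadicAlgebraDegreeOnePlace
import Literature.NumberTheory.Automorphic.AdicCompletionResidueCard
import Literature.NumberTheory.Automorphic.AdicCompletionLocalField
import Mathlib.GroupTheory.IndexNormal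
import HarnessLib

/-!
# The inert prime of the dihedral field and its local data (brick AH1b of the odd-`p` Hecke theta partner)

Route `SignedLowerHalves`, child L `SmallImageLowerHalfBothSigns` (item stmt-BirchSwinnertonDyer-23599), line
`rtt_w3`, stub K0₂@p `stub_heckeThetaPartner_ns` — construction brick AH1b of the arithmetic half at an ODD prime
(width seat `bsd-line-slh-p3-w3` gen 10; memo `Lines/birth_acns-MEMO-w3-g9.md` §2 «AH1»).  THEOREMS ONLY (no
definition, no named fact, no `sorry`); ROUTE-INDEPENDENT.

Setting: `K` a quadratic number field, Galois over `ℚ`; `p` a prime; `v₀` the place of `ℚ` at `p`.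

* `exists_place_asIdeal_eq_span` — if `v₀` is unramified in `K`, its inertia groups lie in `res(Γ_K)` and NO
  arithmetic Frobenius above `v₀` lies in `res(Γ_K)` (the Galois form of «`p` inert», as delivered by the
  small-image datum `…KobayashiMainConjectureSmallImageShadowInert`), then there is a place `v` of `K` with
  `v = p𝓞_K` and `#(𝓞 K / v) = p²` (one place above `v₀`, of residue degree `2`:
  `exists_place_inert_of_not_mem_range`; `(p) = 𝔭_v`: `span_natGenerator_eq_of_singleton`).
* `valued_natCast_eq_exp_neg_one`, `natCast_dvd_of_mem_maximalIdeal`, `isUniformizer_natCast`,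
  `residueFieldCard_eq_sq` — the LOCAL DATA at such a `v`: `|p|_v = exp (-1)`, `𝔪_v = p𝒪_v`, `p` is a
  uniformiser of `K_v` (for the valuative structure of the local field `K_v`), `#𝓀(K_v) = p²`.

These are the hypotheses `hvp, hcard, hgen, hπ, hq` of `heckeThetaPartner_of_inertField` (brick R6).  BSD, crux L
and the stub are NOT proved here.

References: J. Neukirch, ANT I §8 (8.2), I §9 (9.3)–(9.5), II §5; D. A. Marcus, Number Fields, Ch. 4 Thm. 28–29.
-/

set_option autoImplicit false
set_option linter.dupNamespace false

noncomputable section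

open scoped NumberField
open Field NumberField IsDedekindDomain
  Literature.NumberTheory.GaloisRepresentations Literature.NumberTheory.EllipticCurves.ModularForms
  Literature.NumberTheory.GaloisCohomology

namespace Summit.BirchSwinnertonDyer.BirchSwinnertonDyer.Theorems.SmallImageLambdaLowerThreeNsThetaPartner

section Place

variable (K : Type) [Field K] [NumberField K]

/-- **The inert prime `(p) = 𝔭_v`.**  For a quadratic number field `K` and a prime `p` (place `v₀` of `ℚ`) that is
unramified in `K`, with the inertia groups above `v₀` inside `res(Γ_K)` and no arithmetic Frobenius above `v₀` in
`res(Γ_K)`, there is a place `v` of `K` with `v.asIdeal = p𝓞_K` and `#(𝓞 K / v) = p²`.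
[cite: NeukirchANT1999, Ch. I §8 Prop. (8.2), §9 (9.3)–(9.5)] [cite: Marcus2018, Ch. 4, Thm. 28–29] -/
theorem exists_place_asIdeal_eq_span [IsGalois ℚ K] (hK2 : Module.finrank ℚ K = 2) (p : ℕ) [Fact p.Prime]
    {v₀ : HeightOneSpectrum (𝓞 ℚ)} (hpv₀ : (p : 𝓞 ℚ) ∈ v₀.asIdeal)
    (hunr : Algebra.IsUnramifiedIn (𝓞 K) v₀.asIdeal)
    (hin : ∀ 𝔓 ∈ v₀.primesAbove, 𝔓.inertia (absoluteGaloisGroup ℚ) ≤ (absGaloisRestrict ℚ K).range)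
    (hfrob : ∀ 𝔓 ∈ v₀.primesAbove, ∀ σ : absoluteGaloisGroup ℚ,
      IsArithFrobAt (𝓞 ℚ) σ 𝔓 → σ ∉ (absGaloisRestrict ℚ K).range) :
    ∃ v : HeightOneSpectrum (𝓞 K), v.asIdeal = Ideal.span {(p : 𝓞 K)} ∧ Nat.card (𝓞 K ⧸ v.asIdeal) = p ^ 2 := by
  classical
  have hp : p.Prime := Fact.out
  have hl : (Module.finrank ℚ K).Prime := hK2 ▸ Nat.prime_two
  have hHi : ((absGaloisRestrict ℚ K).range).index = Module.finrank ℚ K :=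
    index_range_absGaloisRestrict_eq_finrank' (K := ℚ) K
  have hHn : ((absGaloisRestrict ℚ K).range).Normal := Subgroup.normal_of_index_eq_two (hHi.trans hK2)
  obtain ⟨𝔓₀, h𝔓₀⟩ := v₀.primesAbove_nonempty
  obtain ⟨Φ, hΦ⟩ := HeightOneSpectrum.exists_isArithFrobAt_of_mem_primesAbove_holds (K := ℚ) (v := v₀) h𝔓₀
  obtain ⟨w, -, -, hwv, huniq, hf, -⟩ :=
    exists_place_inert_of_not_mem_range (F := ℚ) (M := K) hl hHn hHi hunr h𝔓₀ (hin 𝔓₀ h𝔓₀) hΦ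
      (hfrob 𝔓₀ h𝔓₀ Φ hΦ)
  have hpgen : Rat.HeightOneSpectrum.natGenerator v₀ = p := LocalField.natGenerator_eq_of_natCast_mem p v₀ hpv₀
  have hS : {w' : HeightOneSpectrum (𝓞 K) | w'.asIdeal.under (𝓞 ℚ) = v₀.asIdeal} = {w} := by
    ext w'
    simp only [Set.mem_setOf_eq, Set.mem_singleton_iff]
    constructor
    · intro h
      exact huniq w' (HeightOneSpectrum.ext (by rw [HeightOneSpectrum.under_asIdeal]; exact h))
    · rintro rfl
      rw [← HeightOneSpectrum.under_asIdeal, hwv]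
  have hspan := span_natGenerator_eq_of_singleton (K := K) hK2 v₀ hS (hf.trans hK2)
  rw [hpgen] at hspan
  refine ⟨w, hspan.symm, ?_⟩
  rw [← Submodule.cardQuot_apply, ← Ideal.absNorm_apply, absNorm_asIdeal_eq_natGenerator_pow, hwv, hpgen, hf, hK2]

end Place

section LocalData

open ValuativeRel Literature.NumberTheory.GaloisRepresentations.IsNonarchimedeanLocalField

variable {K : Type} [Field K] [NumberField K] {p : ℕ} [Fact p.Prime] {v : HeightOneSpectrum (𝓞 K)}

/-- `|p|_v = exp (-1)` when `v = p𝓞_K` (`p` generates the prime `v`, `intValuation_singleton`). [folklore] -/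
theorem valued_natCast_eq_exp_neg_one (hvp : v.asIdeal = Ideal.span {(p : 𝓞 K)}) :
    Valued.v ((p : ℕ) : v.adicCompletion K) = WithZero.exp (-1 : ℤ) := by
  have hp0 : (p : 𝓞 K) ≠ 0 := by exact_mod_cast (Fact.out : p.Prime).ne_zero
  have h1 : ((p : ℕ) : v.adicCompletion K) = ((p : K) : v.adicCompletion K) := by
    rw [show ((p : K) : v.adicCompletion K) = algebraMap K (v.adicCompletion K) (p : K) from rfl, map_natCast]
  have h2 : (p : K) = algebraMap (𝓞 K) K (p : 𝓞 K) := by rw [map_natCast]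
  rw [h1, HeightOneSpectrum.valuedAdicCompletion_eq_valuation', h2, HeightOneSpectrum.valuation_of_algebraMap,
    HeightOneSpectrum.intValuation_singleton _ hp0 hvp]

/-- **`𝔪_v = p𝒪_v`**: every element of the maximal ideal of `𝒪_v = v.adicCompletionIntegers K` is a multiple of
`p` when `v = p𝓞_K` (`e(v ∣ p) = 1`). [cite: NeukirchANT1999, Ch. II §5] -/
theorem natCast_dvd_of_mem_maximalIdeal (hvp : v.asIdeal = Ideal.span {(p : 𝓞 K)}) :
    ∀ c ∈ IsLocalRing.maximalIdeal (v.adicCompletionIntegers K), ((p : ℕ) : v.adicCompletionIntegers K) ∣ c := by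
  intro c hc
  have hvp' : Valued.v (((p : ℕ) : v.adicCompletionIntegers K) : v.adicCompletion K) = WithZero.exp (-1 : ℤ) := by
    rw [show (((p : ℕ) : v.adicCompletionIntegers K) : v.adicCompletion K) = ((p : ℕ) : v.adicCompletion K)
      from rfl]
    exact valued_natCast_eq_exp_neg_one hvp
  rw [HeightOneSpectrum.mem_maximalIdeal_adicCompletionIntegers_iff] at hc
  have hc' : Valued.v (c : v.adicCompletion K) ≤ WithZero.exp (-1 : ℤ) := by
    rcases eq_or_ne (Valued.v (c : v.adicCompletion K)) 0 with h0 | h0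
    · rw [h0]; exact zero_le
    · obtain ⟨a, ha⟩ : ∃ a : ℤ, Valued.v (c : v.adicCompletion K) = WithZero.exp a :=
        ⟨WithZero.log (Valued.v (c : v.adicCompletion K)), (WithZero.exp_log h0).symm⟩
      rw [ha] at hc ⊢
      rw [← WithZero.exp_zero, WithZero.exp_lt_exp] at hc
      rw [WithZero.exp_le_exp]
      omega
  have hpE : (((p : ℕ) : v.adicCompletionIntegers K) : v.adicCompletion K) ≠ 0 := by
    intro h0
    rw [h0, map_zero] at hvp'
    exact WithZero.coe_ne_zero hvp'.symm
  have hmem : (c : v.adicCompletion K) / (((p : ℕ) : v.adicCompletionIntegers K) : v.adicCompletion K) ∈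
      v.adicCompletionIntegers K := by
    rw [HeightOneSpectrum.mem_adicCompletionIntegers, map_div₀, hvp']
    exact div_le_one_of_le₀ hc' zero_le
  refine ⟨⟨(c : v.adicCompletion K) / (((p : ℕ) : v.adicCompletionIntegers K) : v.adicCompletion K), hmem⟩,
    Subtype.ext ?_⟩
  change (c : v.adicCompletion K) =
    (((p : ℕ) : v.adicCompletionIntegers K) : v.adicCompletion K) *
      ((c : v.adicCompletion K) / (((p : ℕ) : v.adicCompletionIntegers K) : v.adicCompletion K))
  rw [mul_div_cancel₀ _ hpE]

/-- The valuation ring `𝒪[K_v]` of the valuative structure of the local field `K_v` is Mathlib's `𝒪_v`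
(`v.adicCompletionIntegers K`) as a subring (equivalent valuations; the `ℚ` case is the tree's
`valuativeInteger_adicCompletion_eq_toSubring`). [folklore] -/
theorem valuativeInteger_adicCompletion_eq_toSubring' (v : HeightOneSpectrum (𝓞 K)) :
    𝒪[v.adicCompletion K] = (v.adicCompletionIntegers K).toSubring := by
  ext x
  rw [Valuation.mem_integer_iff, ValuationSubring.mem_toSubring, HeightOneSpectrum.mem_adicCompletionIntegers]
  exact (ValuativeRel.isEquiv (valuation (v.adicCompletion K))
      (Valued.v : Valuation (v.adicCompletion K) _)).le_one_iff_le_one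

/-- **`p` is irreducible in `𝒪[K_v]`** when `v = p𝓞_K` (`𝔪_v = (p)` in the discrete valuation ring `𝒪_v`,
transported to the valuation ring of the valuative structure). [cite: SerreLocalFields1979, Ch. II §1] -/
theorem irreducible_natCast_valuativeInteger (hvp : v.asIdeal = Ideal.span {(p : 𝓞 K)}) :
    Irreducible ((p : ℕ) : 𝒪[v.adicCompletion K]) := by
  have hp0 : ((p : ℕ) : v.adicCompletionIntegers K) ≠ 0 := by
    intro h0
    have h1 : Valued.v (((p : ℕ) : v.adicCompletionIntegers K) : v.adicCompletion K) = WithZero.exp (-1 : ℤ) :=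
      valued_natCast_eq_exp_neg_one hvp
    rw [h0, ZeroMemClass.coe_zero, map_zero] at h1
    exact WithZero.coe_ne_zero h1.symm
  have hmax : IsLocalRing.maximalIdeal (v.adicCompletionIntegers K) =
      Ideal.span {((p : ℕ) : v.adicCompletionIntegers K)} := by
    apply le_antisymm
    · intro c hc
      exact Ideal.mem_span_singleton.mpr (natCast_dvd_of_mem_maximalIdeal hvp c hc)
    · rw [Ideal.span_singleton_le_iff_mem, HeightOneSpectrum.mem_maximalIdeal_adicCompletionIntegers_iff,
        show (((p : ℕ) : v.adicCompletionIntegers K) : v.adicCompletion K) = ((p : ℕ) : v.adicCompletion K)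
          from rfl, valued_natCast_eq_exp_neg_one hvp, ← WithZero.exp_zero, WithZero.exp_lt_exp]
      decide
  have h1 : Irreducible ((p : ℕ) : v.adicCompletionIntegers K) :=
    IsDiscreteValuationRing.irreducible_of_span_eq_maximalIdeal _ hp0 hmax
  have e' : (v.adicCompletionIntegers K).toSubring ≃+* 𝒪[v.adicCompletion K] :=
    RingEquiv.subringCongr (valuativeInteger_adicCompletion_eq_toSubring' v).symm
  have h2 : Irreducible ((p : ℕ) : (v.adicCompletionIntegers K).toSubring) := h1
  have h3 := h2.map e'
  rwa [map_natCast] at h3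

/-- **`p` is a uniformiser of `K_v`** (Mathlib's `Valuation.IsUniformizer` for the valuative structure of the local
field `K_v`) when `v = p𝓞_K`. [cite: SerreLocalFields1979, Ch. II §1] -/
theorem isUniformizer_natCast (hvp : v.asIdeal = Ideal.span {(p : 𝓞 K)}) :
    (valuation (v.adicCompletion K)).IsUniformizer ((p : ℕ) : v.adicCompletion K) := by
  rw [isUniformizer_iff_valuation_eq_unifValue]
  exact LocalWeilDatum.valuation_eq_unifValue_of_irreducible (v.adicCompletion K)
    (irreducible_natCast_valuativeInteger hvp)

/-- **`#𝓀(K_v) = p²`** when `#(𝓞 K / v) = p²`. [folklore] -/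
theorem residueFieldCard_eq_of_card_quotient {q : ℕ} (hcard : Nat.card (𝓞 K ⧸ v.asIdeal) = q) :
    residueFieldCard (v.adicCompletion K) = q := by
  rw [Literature.NumberTheory.Automorphic.residueFieldCard_adicCompletion_eq, v.residueCard_eq_card_quotient, hcard]

end LocalData

end Summit.BirchSwinnertonDyer.BirchSwinnertonDyer.Theorems.SmallImageLambdaLowerThreeNsThetaPartner

end
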